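import Summits.CriticalPhenomena.PercolationContinuityZ3.Theorems.PercNearOneGluingNoHeavyLowerTailSahiSunflowerTower
import HarnessLib

/-!
# `NoHeavyLowerTail` (crux stmt-CriticalPhenomena-4575), master-family line P2: petal symmetry of the sunflower poset `Sun m` (transport lemmas)

Support file (seat `prim-masterthm-p2`, gen 3; `--supports stmt-CriticalPhenomena-4575`); no named fact, no sorry.  Companion of
`…SahiSunflowerTower` (`Sun m`, `U S`, the structure theorem).  A permutation `π` of the petals is an order automorphism `relabel π`; `E_n`,
Sahi positivity, total mass and `U`-sets transport along it (`sahiE_relabel`, `sahiPositive_relabel`, `sum_relabel`, `U_map_relabel`) — used to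
reduce the co-singleton families of `Sun m` to representatives modulo `Sym(m)`.
-/

namespace Summit.CriticalPhenomena.PercolationContinuityZ3.Theorems.SahiDeltaSystem

open Finset Function Literature.Combinatorics.Sahi2008

namespace Sun

variable {m : ℕ}

/-! ## Petal symmetry -/

/-- Relabelling the petals by a permutation (an order automorphism of `Sun m`). [this work] -/
def relabel (π : Equiv.Perm (Fin m)) : Sun m ≃ Sun m where
  toFun := fun x => match x with | core => core | pet i => pet (π i) | out => out
  invFun := fun x => match x with | core => core | pet i => pet (π.symm i) | out => out
  left_inv := by intro x; rcases x with _ | i | _ <;> simp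
  right_inv := by intro x; rcases x with _ | i | _ <;> simp

/-- `relabel π` on the constructors. [this work] -/
@[simp] theorem relabel_core (π : Equiv.Perm (Fin m)) : relabel π core = core := rfl
/-- `relabel π` on the constructors. [this work] -/
@[simp] theorem relabel_pet (π : Equiv.Perm (Fin m)) (i : Fin m) : relabel π (pet i) = pet (π i) := rfl
/-- `relabel π` on the constructors. [this work] -/
@[simp] theorem relabel_out (π : Equiv.Perm (Fin m)) : relabel π out = out := rfl

/-- `relabel π` is monotone. [this work] -/
theorem monotone_relabel (π : Equiv.Perm (Fin m)) : Monotone (relabel π) := by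
  intro x y hxy
  rw [le_iff] at hxy ⊢
  rcases hxy with rfl | rfl | rfl
  · exact Or.inl rfl
  · exact Or.inr (Or.inl rfl)
  · exact Or.inr (Or.inr rfl)

/-- The inverse relabelling is the relabelling by the inverse. [this work] -/
theorem relabel_symm_apply (π : Equiv.Perm (Fin m)) (x : Sun m) : (relabel π).symm x = relabel π.symm x := by
  rcases x with _ | i | _ <;> rfl

/-- `U S` relabelled is `U (π S)`. [this work] -/
theorem U_map_relabel (π : Equiv.Perm (Fin m)) (S : Finset (Fin m)) :
    (U S).map (relabel π).toEmbedding = U (S.map π.toEmbedding) := by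
  ext x
  rcases x with _ | i | _ <;> simp [U, relabel]

/-- **Transport of `E_n` under a petal relabelling**: `E^ν(π•F) = E^{ν ∘ π}(F)`. [this work] -/
theorem sahiE_relabel (π : Equiv.Perm (Fin m)) (ν : Sun m → ℝ) {n : ℕ} (F : Fin n → Finset (Sun m)) :
    sahiE ν n (fun i => setInd ((F i).map (relabel π).toEmbedding)) = sahiE (ν ∘ relabel π) n (fun i => setInd (F i)) := by
  have hw : pushWeight (ν ∘ relabel π) (relabel π) = ν := by
    funext c; rw [pushWeight_equiv]; simp only [Function.comp_apply, Equiv.apply_symm_apply]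
  have key := sahiE_pushWeight (ν ∘ relabel π) (relabel π) n (fun i => setInd ((F i).map (relabel π).toEmbedding))
  rw [hw] at key
  rw [key]
  congr 1
  funext i x
  simp only [Function.comp_apply, setInd_apply, Finset.mem_map_equiv, Equiv.symm_apply_apply]

/-- Sahi positivity is invariant under petal relabelling. [this work] -/
theorem sahiPositive_relabel (π : Equiv.Perm (Fin m)) {ν : Sun m → ℝ} {n : ℕ} (h : SahiPositive ν n) :
    SahiPositive (ν ∘ relabel π) n := by
  have hw : pushWeight ν (relabel π).symm = ν ∘ relabel π := by
    funext c; rw [pushWeight_equiv]; simp only [Equiv.symm_symm, Function.comp_apply]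
  rw [← hw]
  exact SahiPositive.of_pushWeight h (fun x y hxy => by
    rw [relabel_symm_apply, relabel_symm_apply]; exact monotone_relabel π.symm hxy)

/-- Total mass is invariant under relabelling. [this work] -/
theorem sum_relabel (π : Equiv.Perm (Fin m)) (ν : Sun m → ℝ) : ∑ x, (ν ∘ relabel π) x = ∑ x, ν x :=
  Equiv.sum_comp (relabel π) ν


/-! ## The top row is invariant; normal form of co-singleton families -/

/-- The top row `(U ([m] ∖ i))_i` relabelled is a slot permutation of itself, so its `E_m` is invariant. [this work] -/
theorem row_relabel (π : Equiv.Perm (Fin m)) (ν : Sun m → ℝ) :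
    sahiE (ν ∘ relabel π) m (fun i => setInd (U (Finset.univ.erase i))) = sahiE ν m (fun i => setInd (U (Finset.univ.erase i))) := by
  have h2 := sahiE_relabel π ν (fun i => U (Finset.univ.erase (π.symm i)))
  have h3 : (fun i => setInd ((U (Finset.univ.erase (π.symm i))).map (relabel π).toEmbedding)) =
      fun i => setInd (U (Finset.univ.erase i)) := by
    funext i
    rw [U_map_relabel, Finset.map_erase, Finset.map_univ_equiv]
    simp
  rw [h3] at h2
  rw [h2]
  exact (sahiE_comp_perm (ν ∘ relabel π) m π.symm (fun i => setInd (U (Finset.univ.erase i)))).symm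

/-- A petal permutation sending the distinct witnesses `x i` to the standard positions `castLE i`. [this work] -/
theorem exists_perm_normalising {n : ℕ} (x : Fin n → Fin m) (hx : Function.Injective x) (hn : n ≤ m) :
    ∃ σ : Equiv.Perm (Fin m), ∀ i, σ (x i) = Fin.castLE hn i := by
  classical
  let e : {y // y ∈ Set.range x} ≃ {y // y ∈ Set.range (Fin.castLE hn)} :=
    (Equiv.ofInjective x hx).symm.trans (Equiv.ofInjective (Fin.castLE hn) (Fin.castLE_injective hn))
  refine ⟨e.extendSubtype, fun i => ?_⟩
  rw [Equiv.extendSubtype_apply_of_mem e (x i) ⟨i, rfl⟩]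
  simp [e]

/-- **Normal form.**  In the structure theorem it suffices to check the co-singleton families in NORMAL POSITION — witnesses
`x i = castLE i` (member `i` misses petal `i` and contains the petals `j ≠ i`, `j < k`) — for every RELABELLED weight `ν ∘ relabel π`.
[this work] -/
theorem sahiPositive_of_two_of_normalCoSingleton {ν : Sun m → ℝ} (hν0 : ∀ x, 0 ≤ ν x) (hν1 : ∑ x, ν x = 1) (hS2 : SahiPositive ν 2)
    (hco : ∀ (π : Equiv.Perm (Fin m)) (k : ℕ) (hk : k + 3 ≤ m) (S : Fin (k + 3) → Finset (Fin m)),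
      (∀ i, Fin.castLE hk i ∉ S i) → (∀ i j, i ≠ j → Fin.castLE hk i ∈ S j) →
      0 ≤ sahiE (ν ∘ relabel π) (k + 3) (fun i => setInd (U (S i)))) (n : ℕ) : SahiPositive ν n := by
  refine sahiPositive_of_two_of_coSingleton hν0 hν1 hS2 (fun k S x hx hxS hxS' => ?_) n
  have hk : k + 3 ≤ m := le_of_coSingleton hx
  obtain ⟨σ, hσ⟩ := exists_perm_normalising x hx hk
  let S' : Fin (k + 3) → Finset (Fin m) := fun i => (S i).map σ.toEmbedding
  have hfam : (fun i => setInd (U (S i))) = fun i => setInd ((U (S' i)).map (relabel σ.symm).toEmbedding) := by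
    funext i
    rw [U_map_relabel, Finset.map_map]
    congr 2
    ext y
    simp
  rw [hfam, sahiE_relabel]
  refine hco σ.symm k hk S' (fun i h => hxS i ?_) (fun i j hij => ?_)
  · rw [← hσ i] at h
    simpa [S'] using h
  · have := Finset.mem_map_of_mem σ.toEmbedding (hxS' i j hij)
    rw [Equiv.coe_toEmbedding, hσ i] at this
    exact this


/-! ## Pairs from `e₂(c) ≤ ab` -/

/-- `Σ_{A} c_j² ≤ (Σ_{A} c_j)²` for nonnegative `c`. [folklore] -/
theorem sum_sq_le_sq_sum (c : Fin m → ℝ) (hc : ∀ j, 0 ≤ c j) (A : Finset (Fin m)) :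
    ∑ j ∈ A, c j ^ 2 ≤ (∑ j ∈ A, c j) ^ 2 := by
  rw [sq, Finset.sum_mul]
  refine Finset.sum_le_sum fun i hi => ?_
  rw [sq]
  exact mul_le_mul_of_nonneg_left (Finset.single_le_sum (fun j _ => hc j) hi) (hc i)

/-- For disjoint petal sets, `2·c_A·c_B ≤ (Σ_j c_j)² − Σ_j c_j² = 2e₂(c)`. [folklore] -/
theorem two_mul_prod_le_of_disjoint (c : Fin m → ℝ) (hc : ∀ j, 0 ≤ c j) {A B : Finset (Fin m)} (hAB : Disjoint A B) :
    2 * ((∑ j ∈ A, c j) * ∑ j ∈ B, c j) ≤ (∑ j, c j) ^ 2 - ∑ j, c j ^ 2 := by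
  have hW : ∑ j ∈ A ∪ B, c j = (∑ j ∈ A, c j) + ∑ j ∈ B, c j := Finset.sum_union hAB
  have hW2 : ∑ j ∈ A ∪ B, c j ^ 2 = (∑ j ∈ A, c j ^ 2) + ∑ j ∈ B, c j ^ 2 := Finset.sum_union hAB
  have hU : ∑ j, c j = (∑ j ∈ A ∪ B, c j) + ∑ j ∈ (A ∪ B)ᶜ, c j := (Finset.sum_add_sum_compl (A ∪ B) c).symm
  have hU2 : ∑ j, c j ^ 2 = (∑ j ∈ A ∪ B, c j ^ 2) + ∑ j ∈ (A ∪ B)ᶜ, c j ^ 2 :=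
    (Finset.sum_add_sum_compl (A ∪ B) (fun j => c j ^ 2)).symm
  have hA := sum_sq_le_sq_sum c hc A
  have hB := sum_sq_le_sq_sum c hc B
  have hC := sum_sq_le_sq_sum c hc (A ∪ B)ᶜ
  have hWn : 0 ≤ ∑ j ∈ A ∪ B, c j := Finset.sum_nonneg fun j _ => hc j
  have hCn : 0 ≤ ∑ j ∈ (A ∪ B)ᶜ, c j := Finset.sum_nonneg fun j _ => hc j
  rw [hU, hU2, hW2, hW]
  rw [hW] at hWn
  nlinarith [mul_nonneg hWn hCn]

/-- **Pairs from `e₂(c) ≤ ab`** (the form in which the top row delivers it: `ab ≥ e₂(c) + e₃/(a+1) + …`). [this work] -/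
theorem sahiPositive_two_of_e2 {ν : Sun m → ℝ} (hν0 : ∀ x, 0 ≤ ν x) (hν1 : ∑ x, ν x = 1)
    (he2 : (∑ j, ν (pet j)) ^ 2 - ∑ j, ν (pet j) ^ 2 ≤ 2 * (ν core * ν out)) : SahiPositive ν 2 :=
  sahiPositive_two_of_petalPairs hν0 hν1 fun A B hAB => by
    have h := two_mul_prod_le_of_disjoint (fun j => ν (pet j)) (fun j => hν0 _) hAB
    linarith


/-- **Transport to a representative**: if `S j = ρ(rep (σ j))` for a petal permutation `ρ` and a slot permutation `σ`, then the `E_n` of the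
`U`-family of `S` under `ν` is the `E_n` of the `U`-family of `rep` under `ν ∘ relabel ρ`. [this work] -/
theorem sahiE_transport {n : ℕ} (ν : Sun m → ℝ) (ρ : Equiv.Perm (Fin m)) (σ : Equiv.Perm (Fin n))
    (rep S : Fin n → Finset (Fin m)) (h : ∀ j, S j = (rep (σ j)).map ρ.toEmbedding) :
    sahiE ν n (fun j => setInd (U (S j))) = sahiE (ν ∘ relabel ρ) n (fun j => setInd (U (rep j))) := by
  have e1 : (fun j => setInd (U (S j))) = fun j => setInd ((U (rep (σ j))).map (relabel ρ).toEmbedding) := by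
    funext j; rw [U_map_relabel, ← h j]
  rw [e1, sahiE_relabel]
  exact sahiE_comp_perm (ν ∘ relabel ρ) n σ (fun j => setInd (U (rep j)))

end Sun
end Summit.CriticalPhenomena.PercolationContinuityZ3.Theorems.SahiDeltaSystem
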